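import Mathlib
import HarnessLib
import Summits.Langlands.Langlands.Theses.MaassFreeConverse

/-!
# Birth skeleton (BC3) for crux stmt-Langlands-13898
`Summit.Langlands.Langlands.Theses.MaassFreeConverse.AlgebraicRelationsDecide` — line `birth`

Route `route-Langlands-MaassFreeConverse` (`closes (hB : CriticalValuesBettiRational)
(hD : AlgebraicRelationsDecide) (hG : CriterionDescent) (hJ : RegularSectorJunction) : Langlands`; this
crux is `hD`, rank 3). THE CRUX (card S1+S2 in decidable form, "the Maass-free converse theorem"): for
`m ≥ 1`, `N ≥ 1`, an admissible weight `wt` of `GL_{m+1}` and the compactness facts `hc` there is a VALID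
CRITERION DATUM `(s₀, D_even, D_odd, δ, R)` — `R` a set of finitely supported relations WITH ALGEBRAIC
COEFFICIENTS among the probes `p = ((S', τ), q, χ)` (`τ` cuspidal regular algebraic on `GL_m/ℚ`, `χ` a
Dirichlet character mod `q`) — such that NECESSITY (every cuspidal `π` of `GL_{m+1}/ℚ` of infinity type
`cohomologicalInfinityType (dual wt)` with a `K(N)`-fixed vector kills `R` for some bad-factor data `γ`) and
CONVERSE (a card-`(m+1)` family `α` killing `R` for some `γ` is a.e. the Satake family of such a `π`) hold,
a probe value being `D(τ, parity χ)` times the absolutely convergent twisted Euler product of the local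
multisets `γ⊗β` (`v ∣ N`), `α⊗δ` (`v ∈ S'`), `α⊗β` (elsewhere) at `s₀`.

This file concludes the crux BY NAME from three named stubs along the route's own two-layer plan
(`AlgebraicRelationsDecide ⇐ RationalSpan (Raghuram/Shimura algebraicity for all χ, both parities) →
TwistedEulerIndependence-application → AlgebraicRelationsDecide`), making the one choice the plan leaves
implicit EXPLICIT: the relation set is THE ALGEBRAIC ANNIHILATOR `algAnn` of the GENUINE VALUE TABLE — the
set of finitely supported relations with `ℚ̄`-coefficients, supported on the STANDARD PROBES (`S'` prime to
`N`, `τ` unramified off `S'`, `0 < q`, `τ` of the admissible probe weight `wt'`), that are killed by every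
genuine value vector (the normalised twisted Rankin–Selberg values of a genuine `(π, απ)` with NO bad
factors, `γ = ∅`). With this `R`, ALGEBRAICITY of the coefficients is by construction and NECESSITY is the
EXISTENCE of the genuine values (stub 1, first clause); all the converse content sits in stub 3, which is fed
the twist-aspect independence lemma (stub 2) and the blockwise RATIONALITY of the table (stub 1, second
clause) — the only handle that makes `algAnn` large.

* `stub_genuineValueTable` (L; Raghuram–Shimura algebraicity + absolute convergence) — for some
  admissibility witness `wt'`, a point `s₀`, NON-VANISHING per-parity constants `D_even, D_odd` and
  ramified-`τ` data `δ`: (EXISTENCE) every genuine `(π, απ)` has a `γ = ∅` value at every standard probe,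
  and (RATIONALITY) on every block (probe type `(S', τ)`, parity of `χ`) a genuine value vector is ONE
  complex constant times a `ℚ̄`-valued vector (intended: `s₀` = a right-half critical point of
  `L(s, π ⊗ χ × τ)`, `D = 1`, constant `= p^{±}(π) p^{∓}(τ) p_∞`; Raghuram 2009/2016 Thm 1.1 with the
  Raghuram–Shahidi period relations under twisting; convergence from Jacquet–Shalika / Luo–Rudnick–Sarnak
  bounds — the route's recorded why-might-fail; no cross-`τ` constants are claimed).
* `stub_eulerIndependence` (M/L; provable now) — the route's support item `TwistedEulerIndependence`
  (stmt-Langlands-13628) in the form the converse consumes: finitely many families of local multisets of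
  non-zero numbers, termwise `‖x‖ < q_v^{Re s₀}` and SUMMABLE `∑_v ∑_x ‖x‖ q_v^{-Re s₀}` (the crux's own
  convergence clauses, in place of the support item's `‖x‖ ≤ C q_v^θ`, `1 + θ < Re s₀`, `card ≤ k`, which imply
  them): a linear relation among their twisted Euler products, as functions of the Dirichlet characters of
  a fixed parity and modulus prime to `B`, has coefficient sum zero on every a.e.-equality class of families
  — for pairwise a.e.-different families, linear independence (orthogonality over `χ mod q`, `q → ∞` prime,
  extracts the Dirichlet coefficients of absolutely convergent series; then induction on the number of
  classes with a separating place).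
* `stub_annihilatorConverse` (XL, THE HEART and the risk) — given the independence lemma, for EVERY
  admissibility witness `wt'` and every datum with non-vanishing `D` whose genuine table is total and
  blockwise rational, the algebraic annihilator DECIDES: a card-`(m+1)` family `α` with bad data `γ` killing
  `algAnn` is a.e. the Satake family of a genuine `π` (linear algebra: on every finite set of standard probes
  the algebraic annihilator spans the annihilator of the rational lines, so a killed value vector lies
  locally, hence — the span being finite-dimensional by Harish-Chandra finiteness — globally in the span of
  the genuine vectors of its parity; stub 2 then puts a genuine family in the candidate's a.e.-class for
  every probe type `τ`, the finitely many differing Euler factors must have a `χ`-constant ratio, hence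
  there are none, and power-sum recovery over the probe types `τ` gives `α_v = απ_v` for a.e. `v` and one
  `π`).
* `AlgebraicRelationsDecide_of : stubs 1–3 → AlgebraicRelationsDecide` — kernel-checked, no `sorry`: take
  the datum of stub 1 and `R := algAnn`; coefficients are algebraic by definition of `algAnn`; NECESSITY with
  `γ := ∅`: the value vector `z` of `(π, απ)` chosen (classically) from the EXISTENCE clause is a genuine
  vector, so every `r ∈ algAnn` has `∑ r p · z p = 0` and its support lies in the standard probes where `z`
  has the value property; CONVERSE is stub 3 fed stub 2 and both clauses of stub 1.

Shape (for `ledger skeleton check` / `#h21_check_skeleton`): stubs are `theorem stub_<name> (binders) :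
<goal> := by sorry`; `_Goal.stub_<name> : Prop := type_of% @stub_<name>` names each statement; the
composition takes `(h₁ : _Goal.stub_genuineValueTable) (h₂ : _Goal.stub_eulerIndependence)
(h₃ : _Goal.stub_annihilatorConverse)` and concludes the route decl by name; the final `example` feeds
the three stubs to it. Sorries: exactly the three stubs.

Disproof used: none relevant — the crux has no `Disproof.lean` / Negative lemma (`ledger crux ls
stmt-Langlands-13898`: no workfiles before this one); the negatives index of the summit (K3 Kuga–Satake
entry) does not touch this line. Honoured instead: the route's own why-might-fail for this crux
("NECESSITY near print; CONVERSE unprinted: fails in substance if for some admissible (m,N,wt) a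
non-automorphic Euler family kills the ℚ̄-annihilator of the finitely many genuine value vectors; dep
13628 lacks summability") — the `ℚ̄`-annihilator is exactly `algAnn`, the substance risk is exactly stub 3,
and stub 2 is dep 13628 WITH the summability hypothesis; the refuter/grounder notes on the item
(2026-08-15: "TEI must be used in a summable / zero-stripped TAIL-CLASS variant", "relations must use probes
with S' ⊇ Ram(τ)", "D ≠ 0", "maximal R = the ℚ̄-annihilator of the finitely many genuine vectors", "cross-τ
constants not load-bearing") — stub 2's class form, `StdProbe`, `GoodDatum`, `algAnn` and the BLOCKWISE
rational lines respectively; and the gen-1 refutation mode (finite probe sets ⇒ zero-padding / perturbation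
counterexamples): the standard probes contain ALL `χ`-twists of every modulus `q > 0` for every admissible
`τ`, and candidates carry card-`(m+1)` families at every place. Tree facts the stubs will want:
`AutomorphicRepData.hasSatakeParamAt_unique_holds` / `hasSatakeParamAt_cofinite_holds` (proved),
`harishChandra_finiteness_gl`, `strong_multiplicity_one_gl` (named facts).
-/

set_option linter.dupNamespace false

noncomputable section

namespace Summit.Langlands.Langlands.Cruxes.AlgebraicRelationsDecide.Birth

open Summit.Langlands.Langlands.Theses.MaassFreeConverse
open scoped BigOperators Topology Manifold Classical MeasureTheory ProbabilityTheory Matrix InnerProductSpace ComplexConjugate ContinuousMap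
open Filter Set Function TopologicalSpace MeasureTheory
open Literature.NumberTheory.Automorphic Literature.NumberTheory.GaloisRepresentations Literature.NumberTheory.DiophantineGeometry Literature.Barriers.Langlands IsDedekindDomain NumberField

/-! ## 0. Named copies of the crux's clauses (verbatim; `algebraicRelationsDecide_iff` is `Iff.rfl`) -/

/-- The crux's compactness facts `hc` (all discharged in the tree by
`isCompact_glFiniteIntegralLevel_holds`; kept as a binder because the probe types mention `hc m`). [folklore] -/
@[folklore] abbrev CompactFacts : Prop := ∀ j : ℕ, isCompact_glFiniteIntegralLevel j ℚ

/-- PROBE TYPES `t = (S', τ)`: a finite set of places and a cuspidal regular algebraic `τ` on `GL_m/ℚ`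
(the crux's `((_ : Finset _) × {τ // τ.1.IsRegularAlgebraic})`). [folklore] -/
abbrev ProbeType (m : ℕ) (hc : CompactFacts) :=
  (_ : Finset (HeightOneSpectrum (𝓞 ℚ))) × {τ : CuspidalAutomorphicRepData m ℚ (hc m) // τ.1.IsRegularAlgebraic}

/-- PROBES `p = ((S', τ), q, χ)`, `χ` a Dirichlet character mod `q` (the crux's index type of the
relations). [folklore] -/
abbrev Probe (m : ℕ) (hc : CompactFacts) :=
  (_ : ProbeType m hc) × (q : ℕ) × DirichletCharacter ℂ q

/-- ADMISSIBILITY WITNESS: `wt'` is a pure weight of `GL_m` whose three consecutive shifts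
`wt' + (j-1), wt' + j, wt' + (j+1)` have duals interlacing `wt` (the crux's hypothesis on `wt` is
`∃ wt', AdmissibleWitness m wt wt'`, definitionally). [cite: KastenSchmidt2012, §3.1 and §3.5] -/
@[folklore] def AdmissibleWitness (m : ℕ) (wt : Fin (m + 1) → ℤ) (wt' : Fin m → ℤ) : Prop :=
  ∃ (w' j : ℤ), (∀ i, wt' i + wt' (Fin.rev i) = w') ∧ (∀ i : Fin m, -(wt' i.rev + (j - 1)) ≤ wt i.castSucc ∧ wt i.succ ≤ -(wt' i.rev + (j - 1))) ∧ (∀ i : Fin m, -(wt' i.rev + j) ≤ wt i.castSucc ∧ wt i.succ ≤ -(wt' i.rev + j)) ∧ (∀ i : Fin m, -(wt' i.rev + (j + 1)) ≤ wt i.castSucc ∧ wt i.succ ≤ -(wt' i.rev + (j + 1)))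

/-- GENUINE `π`: cuspidal on `GL_{m+1}/ℚ`, infinity type `cohomologicalInfinityType (dual wt)`, with a
`K(N)`-fixed form (the crux's hypothesis on `π`, verbatim). [cite: Clozel1990, §3.3] -/
@[folklore] def IsGenuine {m : ℕ} {hc : CompactFacts} (N : ℕ) (wt : Fin (m + 1) → ℤ)
    (π : CuspidalAutomorphicRepData (m + 1) ℚ (hc (m + 1))) : Prop :=
  π.1.HasInfinityType (cohomologicalInfinityType (m + 1) ℚ (Weight.dual wt)) ∧ ∃ φ ∈ π.1.W, φ ∉ π.1.W' ∧ ∀ u ∈ principalCongruenceLevel (m + 1) ℚ (Ideal.span {(N : 𝓞 ℚ)}), rightTranslation (AdelicGroupData.gl (m + 1) ℚ) u φ = φ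

/-- `απ` is a SATAKE FAMILY of `π` OFF `N` (the crux's hypothesis on `απ`, verbatim). [cite: BorelJacquet1979, 4.6] -/
@[folklore] def SatakeOffN {m : ℕ} {hc : CompactFacts} (N : ℕ) (π : CuspidalAutomorphicRepData (m + 1) ℚ (hc (m + 1)))
    (απ : HeightOneSpectrum (𝓞 ℚ) → Multiset ℂ) : Prop :=
  ∀ v, ¬ v.asIdeal ∣ Ideal.span {(N : 𝓞 ℚ)} → π.1.HasSatakeParamAt v (απ v)

/-- THE VALUE PROPERTY (verbatim the crux's inner clause): `zp` is the value of the probe `p = ((S', τ), q, χ)`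
on the candidate `α` with bad-factor data `γ` for the datum `(N, s₀, D_even, D_odd, δ)` — `β` a Satake family
of `τ` off `S'`, `L` the local multisets (`γ⊗β` at `v ∣ N`, `α⊗δ` at `v ∈ S'`, `v ∤ N`, `α⊗β` elsewhere),
termwise `‖y‖ < q_v^{Re s₀}`, summable, partial twisted Euler products at `s₀` tending to `E ≠ 0`, and
`zp = D(parity χ) · E`. [cite: KastenSchmidt2012, §3.6] -/
@[folklore] def ProbeValue {m : ℕ} {hc : CompactFacts} (N : ℕ) (s₀ : ℂ) (De Do : ProbeType m hc → ℂ)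
    (δ : ProbeType m hc → HeightOneSpectrum (𝓞 ℚ) → Multiset ℂ) (α γ : HeightOneSpectrum (𝓞 ℚ) → Multiset ℂ)
    (p : Probe m hc) (zp : ℂ) : Prop :=
  ∃ (β L : HeightOneSpectrum (𝓞 ℚ) → Multiset ℂ) (E : ℂ), (∀ v, v ∉ p.1.1 → p.1.2.1.1.HasSatakeParamAt v (β v)) ∧ (∀ v, L v = ((if v.asIdeal ∣ Ideal.span {(N : 𝓞 ℚ)} then γ v else α v).bind fun a => (if ¬ v.asIdeal ∣ Ideal.span {(N : 𝓞 ℚ)} ∧ v ∈ p.1.1 then δ p.1 v else β v).map fun b => a * b)) ∧ (∀ v, ∀ y ∈ L v, ‖y‖ < (v.residueCard : ℝ) ^ s₀.re) ∧ (Summable fun v : HeightOneSpectrum (𝓞 ℚ) => ((L v).map fun y => ‖y‖ * (v.residueCard : ℝ) ^ (-s₀.re)).sum) ∧ Tendsto (fun X : ℕ => ∏ᶠ v ∈ {v : HeightOneSpectrum (𝓞 ℚ) | v.residueCard ≤ X}, ((L v).map fun y => (1 - y * p.2.2 (v.residueCard : ZMod p.2.1) * (v.residueCard : ℂ) ^ (-s₀))⁻¹).prod)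 atTop (𝓝 E) ∧ E ≠ 0 ∧ zp = (if p.2.2.Even then De p.1 else Do p.1) * E

/-- `(α, γ)` KILLS the relation set `R`: every `r ∈ R` vanishes on some value vector of `(α, γ)` defined on its
support (verbatim the crux's `∀ r ∈ R, ∃ z, …`). [folklore] -/
@[folklore] def Kills {m : ℕ} {hc : CompactFacts} (N : ℕ) (s₀ : ℂ) (De Do : ProbeType m hc → ℂ)
    (δ : ProbeType m hc → HeightOneSpectrum (𝓞 ℚ) → Multiset ℂ) (R : Set ((Probe m hc) →₀ ℂ))
    (α γ : HeightOneSpectrum (𝓞 ℚ) → Multiset ℂ) : Prop :=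
  ∀ r ∈ R, ∃ z : _ → ℂ, (∀ p ∈ r.support, ProbeValue N s₀ De Do δ α γ p (z p)) ∧ ∑ p ∈ r.support, r p * z p = 0

/-- ALGEBRAIC COEFFICIENTS (the crux's first conjunct). [folklore] -/
@[folklore] def AlgCoeff {m : ℕ} {hc : CompactFacts} (R : Set ((Probe m hc) →₀ ℂ)) : Prop :=
  ∀ r ∈ R, ∀ p, IsAlgebraic ℚ (r p)

/-- NECESSITY (the crux's second conjunct): every genuine `(π, απ)` kills `R` for some `γ`. [folklore] -/
@[folklore] def Necessity {m : ℕ} {hc : CompactFacts} (N : ℕ) (wt : Fin (m + 1) → ℤ) (s₀ : ℂ) (De Do : ProbeType m hc → ℂ)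
    (δ : ProbeType m hc → HeightOneSpectrum (𝓞 ℚ) → Multiset ℂ) (R : Set ((Probe m hc) →₀ ℂ)) : Prop :=
  ∀ π : CuspidalAutomorphicRepData (m + 1) ℚ (hc (m + 1)), IsGenuine N wt π → ∀ απ : HeightOneSpectrum (𝓞 ℚ) → Multiset ℂ, SatakeOffN N π απ → ∃ γ : HeightOneSpectrum (𝓞 ℚ) → Multiset ℂ, Kills N s₀ De Do δ R απ γ

/-- CONVERSE (the crux's third conjunct): a card-`(m+1)` family killing `R` for some `γ` is a.e. the Satake
family of a genuine `π`. [folklore] -/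
@[folklore] def Converse {m : ℕ} {hc : CompactFacts} (N : ℕ) (wt : Fin (m + 1) → ℤ) (s₀ : ℂ) (De Do : ProbeType m hc → ℂ)
    (δ : ProbeType m hc → HeightOneSpectrum (𝓞 ℚ) → Multiset ℂ) (R : Set ((Probe m hc) →₀ ℂ)) : Prop :=
  ∀ α γ : HeightOneSpectrum (𝓞 ℚ) → Multiset ℂ, (∀ v, Multiset.card (α v) = m + 1) → Kills N s₀ De Do δ R α γ → ∃ π : CuspidalAutomorphicRepData (m + 1) ℚ (hc (m + 1)), IsGenuine N wt π ∧ ∀ᶠ v in cofinite, π.1.HasSatakeParamAt v (α v)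

/-- The crux unfolded over the named clauses (definitional). [folklore] -/
theorem algebraicRelationsDecide_iff : AlgebraicRelationsDecide ↔
    ∀ (m : ℕ), 1 ≤ m → ∀ (N : ℕ), 1 ≤ N → ∀ (wt : Fin (m + 1) → ℤ), (∃ wt' : Fin m → ℤ, AdmissibleWitness m wt wt') →
      ∀ (hc : CompactFacts), ∃ (s₀ : ℂ) (De Do : ProbeType m hc → ℂ)
        (δ : ProbeType m hc → HeightOneSpectrum (𝓞 ℚ) → Multiset ℂ) (R : Set ((Probe m hc) →₀ ℂ)),
        AlgCoeff R ∧ Necessity N wt s₀ De Do δ R ∧ Converse N wt s₀ De Do δ R :=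
  Iff.rfl

/-! ## 1. The line's own objects: standard probes, the genuine value table, rational lines, `algAnn` -/

/-- NO BAD FACTORS: the empty bad-factor datum `γ = ∅` (Euler factor `1` at every `v ∣ N`). [folklore] -/
def noBad : HeightOneSpectrum (𝓞 ℚ) → Multiset ℂ := fun _ => 0

/-- STANDARD PROBES for level `N` and probe weight `wt'`: `S'` prime to `N` (so that at `v ∣ N` the local
multiset is `γ_v ⊗ β_v` with `β_v` a genuine Satake parameter of `τ`), `τ` unramified off `S'` (so that `β`
exists), modulus `q > 0`, and `τ` of the cohomological infinity type of weight `wt'` (so that ONE point `s₀`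
is critical and absolutely convergent for all probes at once). [cite: KastenSchmidt2012, §3.6] -/
@[folklore] def StdProbe {m : ℕ} {hc : CompactFacts} (N : ℕ) (wt' : Fin m → ℤ) (p : Probe m hc) : Prop :=
  (∀ v ∈ p.1.1, ¬ v.asIdeal ∣ Ideal.span {(N : 𝓞 ℚ)}) ∧ (∀ v, v ∉ p.1.1 → p.1.2.1.1.IsUnramifiedAt v) ∧
    0 < p.2.1 ∧ p.1.2.1.1.HasInfinityType (cohomologicalInfinityType m ℚ (Weight.dual wt'))

/-- GENUINE VALUE VECTOR: `u` agrees on every standard probe with a `γ = ∅` value of some genuine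
`(π, απ)` (off the standard probes `u` is unconstrained — `algAnn` never reads those entries).
[cite: Raghuram2009, Thm 1.1] -/
@[folklore] def IsGenuineVector {m : ℕ} {hc : CompactFacts} (N : ℕ) (wt : Fin (m + 1) → ℤ) (wt' : Fin m → ℤ) (s₀ : ℂ)
    (De Do : ProbeType m hc → ℂ) (δ : ProbeType m hc → HeightOneSpectrum (𝓞 ℚ) → Multiset ℂ)
    (u : Probe m hc → ℂ) : Prop :=
  ∃ (π : CuspidalAutomorphicRepData (m + 1) ℚ (hc (m + 1))) (απ : HeightOneSpectrum (𝓞 ℚ) → Multiset ℂ),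
    IsGenuine N wt π ∧ SatakeOffN N π απ ∧ ∀ p, StdProbe N wt' p → ProbeValue N s₀ De Do δ απ noBad p (u p)

/-- BLOCKWISE RATIONAL LINES: on the standard probes of each probe type `t = (S', τ)`, `u = c_even(t) · a`
on even `χ` and `c_odd(t) · a` on odd `χ` with `a` `ℚ̄`-valued — one `ℚ̄`-line per BLOCK `(t, parity)` (the
constants are the products `p^{±}(π) p^{∓}(τ) p_∞` of Raghuram's theorem, whose signs depend on `τ` and on the
parity of `χ` only, by the Raghuram–Shahidi period relations under twisting; `a` absorbs `ℚ(χ)`, Gauss sums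
and the dropped or modified Euler factors; NO cross-`τ` constants are asserted).
[cite: Raghuram2009, Thm 1.1] [cite: RaghuramShahidi2010, Thm 1.1] -/
@[folklore] def OnRationalLines {m : ℕ} {hc : CompactFacts} (N : ℕ) (wt' : Fin m → ℤ) (u : Probe m hc → ℂ) : Prop :=
  ∀ t : ProbeType m hc, ∃ (ce co : ℂ) (a : ((q : ℕ) × DirichletCharacter ℂ q) → ℂ), (∀ x, IsAlgebraic ℚ (a x)) ∧
    ∀ x : (q : ℕ) × DirichletCharacter ℂ q, StdProbe N wt' ⟨t, x⟩ → u ⟨t, x⟩ = (if x.2.Even then ce else co) * a x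

/-- THE LINE'S RELATION SET — the ALGEBRAIC ANNIHILATOR of the genuine value table: finitely supported
relations with `ℚ̄`-coefficients, supported on standard probes, killed by every genuine value vector.
[cite: KastenSchmidt2012, §3.6] [cite: LuoRamakrishnan1997, Thm A] -/
def algAnn {m : ℕ} {hc : CompactFacts} (N : ℕ) (wt : Fin (m + 1) → ℤ) (wt' : Fin m → ℤ) (s₀ : ℂ)
    (De Do : ProbeType m hc → ℂ) (δ : ProbeType m hc → HeightOneSpectrum (𝓞 ℚ) → Multiset ℂ) :
    Set ((Probe m hc) →₀ ℂ) :=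
  {r | (∀ p, IsAlgebraic ℚ (r p)) ∧ (∀ p ∈ r.support, StdProbe N wt' p) ∧
    ∀ u, IsGenuineVector N wt wt' s₀ De Do δ u → ∑ p ∈ r.support, r p * u p = 0}

/-- GOOD DATUM: the per-parity normalising constants never vanish (`D = c_∞^±/p^±(τ) ≠ 0`), so that a probe
value is zero only if its Euler product is — never. [cite: Raghuram2009, Thm 1.1] -/
@[folklore] def GoodDatum {m : ℕ} {hc : CompactFacts} (De Do : ProbeType m hc → ℂ) : Prop :=
  ∀ t, De t ≠ 0 ∧ Do t ≠ 0

/-- EXISTENCE clause of the genuine table: every genuine `(π, απ)` has a `γ = ∅` value at every standard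
probe (absolute convergence and non-vanishing of the twisted Rankin–Selberg Euler product at `s₀`).
[cite: JacquetShalikaAJM1981, Thm 5.3] -/
@[folklore] def TableTotal {m : ℕ} {hc : CompactFacts} (N : ℕ) (wt : Fin (m + 1) → ℤ) (wt' : Fin m → ℤ) (s₀ : ℂ)
    (De Do : ProbeType m hc → ℂ) (δ : ProbeType m hc → HeightOneSpectrum (𝓞 ℚ) → Multiset ℂ) : Prop :=
  ∀ π : CuspidalAutomorphicRepData (m + 1) ℚ (hc (m + 1)), IsGenuine N wt π →
    ∀ απ : HeightOneSpectrum (𝓞 ℚ) → Multiset ℂ, SatakeOffN N π απ →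
      ∀ p : Probe m hc, StdProbe N wt' p → ∃ zp : ℂ, ProbeValue N s₀ De Do δ απ noBad p zp

/-- RATIONALITY clause of the genuine table: every genuine value vector lies on the blockwise (per probe type
and parity) rational lines. [cite: Raghuram2009, Thm 1.1] -/
@[folklore] def TableRational {m : ℕ} {hc : CompactFacts} (N : ℕ) (wt : Fin (m + 1) → ℤ) (wt' : Fin m → ℤ) (s₀ : ℂ)
    (De Do : ProbeType m hc → ℂ) (δ : ProbeType m hc → HeightOneSpectrum (𝓞 ℚ) → Multiset ℂ) : Prop :=
  ∀ u : Probe m hc → ℂ, IsGenuineVector N wt wt' s₀ De Do δ u → OnRationalLines N wt' u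

/-- TWIST-ASPECT INDEPENDENCE OF EULER PRODUCTS, CLASS FORM (the route's support item
`TwistedEulerIndependence`, stmt-Langlands-13628, with the crux's own convergence clauses as hypotheses and
the conclusion sharpened to what the converse consumes): finitely many families
`M_i : places → multisets of non-zero complex numbers` with `‖x‖ < q_v^{Re s₀}` termwise and
`∑_v ∑_{x ∈ M_i v} ‖x‖ q_v^{-Re s₀} < ∞`; if a linear combination `∑_i c_i e_i` of the functions
`e_i : (q, χ) ↦ lim_X ∏_{q_v ≤ X} ∏_{x ∈ M_i v} (1 − x χ(v) q_v^{−s₀})^{−1}` vanishes on all Dirichlet characters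
of parity `b` and modulus `q > 0` prime to `B`, then on every ALMOST-EVERYWHERE-EQUALITY CLASS of families
(`M_i ~ M_j` iff `M_i v ≠ M_j v` at finitely many `v` only) the coefficients sum to zero. For pairwise
a.e.-different families the classes are singletons: linear independence (the support item). (Infinite
distinctness is what separates classes: Euler products differing at one place can be dependent,
`1/((1−yX)(1−zX)) = 2/((1−xX)(1−zX)) − 1/((1−xX)(1−yX))` for `x, y, z` in arithmetic progression — but the
coefficients `1, −2, 1` of that single class do sum to zero.) [cite: LuoRamakrishnan1997, Thm A] -/
@[folklore] def EulerIndependence : Prop :=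
  ∀ (B : Finset (HeightOneSpectrum (𝓞 ℚ))) (s₀ : ℂ) (r : ℕ) (b : Bool)
    (M : Fin r → HeightOneSpectrum (𝓞 ℚ) → Multiset ℂ),
    (∀ i v, ∀ x ∈ M i v, x ≠ 0 ∧ ‖x‖ < (v.residueCard : ℝ) ^ s₀.re) →
    (∀ i, Summable fun v : HeightOneSpectrum (𝓞 ℚ) => ((M i v).map fun x => ‖x‖ * (v.residueCard : ℝ) ^ (-s₀.re)).sum) →
    ∀ e : Fin r → {x : (q : ℕ) × DirichletCharacter ℂ q // 0 < x.1 ∧ (∀ v ∈ B, ¬ v.residueCard ∣ x.1) ∧ x.2 (-1) = (if b then 1 else -1)} → ℂ,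
      (∀ i x, Tendsto (fun X : ℕ => ∏ᶠ v ∈ {v : HeightOneSpectrum (𝓞 ℚ) | v.residueCard ≤ X}, ((M i v).map fun y => (1 - y * x.1.2 (v.residueCard : ZMod x.1.1) * (v.residueCard : ℂ) ^ (-s₀))⁻¹).prod) atTop (𝓝 (e i x))) →
      ∀ c : Fin r → ℂ, (∀ x, ∑ i, c i * e i x = 0) →
        ∀ i, ∑ j ∈ Finset.univ.filter (fun j => {v : HeightOneSpectrum (𝓞 ℚ) | M i v ≠ M j v}.Finite), c j = 0

/-! ## 2. The stubs (the ONLY sorries of this file) -/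

/-- **STUB 1 — the genuine value table: existence and per-parity rationality** (L; the NECESSITY engine).
For `m ≥ 1`, `N ≥ 1`, admissible `wt` there are an admissibility witness `wt'`, a point `s₀`, non-vanishing
per-parity constants `D_even, D_odd` and ramified-`τ` data `δ` such that (EXISTENCE) for every genuine
`(π, απ)` and every standard probe `((S', τ), q, χ)` the twisted Rankin–Selberg Euler product of
`απ ⊗ β(τ)` (`απ ⊗ δ` on `S'`, NOTHING at `v ∣ N`) converges absolutely at `s₀` to a non-zero limit, and
(RATIONALITY) on each block (probe type `(S', τ)`, parity of `χ`) the resulting values of `(π, απ)` are ONE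
complex constant times `ℚ̄`-valued numbers. Intended witness: `τ` of coefficient weight `wt'`, `s₀` the
interior (or rightmost) right-half critical point of `L(s, π ⊗ χ × τ)` guaranteed by the three interlacings,
`D_even = D_odd = 1` (any non-zero constants do; the route's `c_∞/p(τ)` normalisation is not needed once
lines are blockwise), `δ(S', τ)_v` = the `L`-parameters of `τ_v` (or `∅`). Proof route: Raghuram's algebraicity theorem for
`GL_{m+1} × GL_m` critical values applied to `(π, τ ⊗ χ)` for all `χ` (`L_f(s₀) ∈ p^{ε}(π) p^{η}(τ ⊗ χ) p_∞ ℚ̄`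
with signs fixed by `τ` and the parity of `χ`; Sun's non-vanishing of `p_∞`) and the Raghuram–Shahidi
relation `p^{η}(τ ⊗ χ) ∼ p^{η·χ(-1)}(τ) G(χ)^{…}`; the dropped Euler factors at `v ∣ N`, the `δ`-factors and
Gauss sums are algebraic (Satake parameters of cohomological `π`, `τ` are algebraic, Clozel) and go into `a`;
absolute convergence at `s₀` from the Jacquet–Shalika / Luo–Rudnick–Sarnak bounds towards Ramanujan for `π`
and tempered `τ` (the route's recorded risk: "LRS + tempered τ for summability" — for `m + 1 ≥ 3` and
non-polarisable `π` temperedness at the critical `s₀` is the bet).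
[cite: Raghuram2009, Thm 1.1] [cite: RaghuramShahidi2010, Thm 1.1] [cite: Sun2016, Thm 1.1] [cite: JacquetShalikaAJM1981, Thm 5.3] -/
theorem stub_genuineValueTable (m : ℕ) (hm : 1 ≤ m) (N : ℕ) (hN : 1 ≤ N) (wt : Fin (m + 1) → ℤ)
    (hwt : ∃ wt' : Fin m → ℤ, AdmissibleWitness m wt wt') (hc : CompactFacts) :
    ∃ (wt' : Fin m → ℤ) (s₀ : ℂ) (De Do : ProbeType m hc → ℂ)
      (δ : ProbeType m hc → HeightOneSpectrum (𝓞 ℚ) → Multiset ℂ),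
      AdmissibleWitness m wt wt' ∧ GoodDatum De Do ∧
        TableTotal N wt wt' s₀ De Do δ ∧ TableRational N wt wt' s₀ De Do δ := by
  sorry

/-- **STUB 2 — twist-aspect independence of Euler products, class form** (M/L; provable now; implies
the route's support item `TwistedEulerIndependence` = stmt-Langlands-13628, whose polynomial bounds
`‖x‖ ≤ C q_v^θ`, `1 + θ < Re s₀`, `card ≤ k` give the summability assumed here and whose pairwise
a.e.-difference makes every class a singleton). Proof route: absolute convergence makes `e_i(q, χ)` the
Dirichlet series `∑_{n ≥ 1} a_i(n) χ(n) n^{-s₀}` with `a_i` multiplicative, `a_i(ℓ^k) = h_k(M_i(ℓ))`;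
averaging `∑ c_i e_i = 0` against `χ̄(n)` over the characters of parity `b` mod a prime `q → ∞` extracts
`∑_i c_i a_i(n) = 0` for every `n ≥ 1` (tails of absolutely convergent series vanish); for `n` prime to the
finite set `V` of places where a.e.-equal families differ, `a_i(n)` depends only on the class, giving
`∑_C (∑_{i ∈ C} c_i) a_C(n) = 0`; a shortest such relation among pairwise infinitely-different class
representatives is shortened by a separating place `v ∉ V ∪ B'` with `h_k(M_C v) ≠ h_k(M_{C'} v)` (non-zero
entries ⇒ some `h_k` differs; multiplicativity at `n ↦ n ℓ_v^k`) — contradiction, so every class sum is `0`.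
[cite: LuoRamakrishnan1997, Thm A] -/
theorem stub_eulerIndependence : EulerIndependence := by
  sorry

/-- **STUB 3 — the algebraic annihilator decides** (XL; THE HEART: the Maass-free converse theorem proper).
Given twist-aspect independence, for every admissibility witness `wt'` and every datum `(s₀, D, δ)` with
non-vanishing `D` whose genuine `γ = ∅` value table is total and blockwise rational: a card-`(m+1)` family
`α` with bad-factor data `γ` that kills every algebraic relation killed by the genuine table is, at almost
every place, a Satake parameter of ONE genuine `π` (cuspidal, infinity type `cohomologicalInfinityType
(dual wt)`, `K(N)`-fixed vector). Proof route: (i) LINEAR ALGEBRA — on a finite set `P` of standard probes inside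
one block (probe type `t`, one parity) the annihilator of the genuine vectors is the kernel of the matrix
`(a_u(p))` with `ℚ̄`-entries (`u = c_t^±(u) a_u` on the block, `c ≠ 0` because `D ≠ 0` and Euler products do
not vanish), hence spanned by `ℚ̄`-vectors, all in `algAnn`; so the candidate's value vector (well defined at
every standard probe: Cramer gives a relation of `algAnn` through any given probe; unique by uniqueness of
Satake parameters, Flath) lies on each `P` in the span of the genuine vectors and — that span being
finite-dimensional (Harish-Chandra: finitely many genuine `π` of weight `wt` and level `K(N)`) — on the whole
block: `z = ∑_u λ_u(t, ±) u` there; (ii) EULER RIGIDITY — dividing by `D_±(S', τ)`, for each probe type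
`(S', τ)` and parity the candidate's twisted Euler products are ONE fixed combination of the genuine ones for
all `χ` of that parity and all moduli; by STUB 2
(zeros filtered) the coefficients of the candidate's a.e.-class sum to `1`, so the class contains a genuine
family, and since a.e.-equal GENUINE families are equal (strong multiplicity one) the finitely many Euler
factors by which the candidate differs from it inside the class give a ratio `∏_{v ∈ F} f_v(χ(v))` that must
be constant in `χ` — impossible for a non-trivial local factor evaluated at infinitely many roots of unity —
so `F = ∅`: `α_v ⊗ β_v(τ) = απ_v ⊗ β_v(τ)` at EVERY `v ∤ N` off `S'` (and `γ_v ⊗ β_v(τ)` has trivial Euler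
factor at `v ∣ N`); (iii) RECOVERY — place by place, a probe `τ` of weight `wt'` with all power sums
`p_k(β_v(τ))`, `k ≤ (m+1)m`, non-zero (e.g. an induced `τ` with `v` split; vertical equidistribution) turns
`p_k(α_v) p_k(β_v) = p_k(απ_v) p_k(β_v)` into `α_v = απ_v`, and one `π` serves all `τ` by strong multiplicity
one (Chebotarev for the Galois representations of lang.S27 where densities are needed). Why it might fail
(the route's): for some admissible `(m, N, wt)` a non-automorphic Euler family kills the `ℚ̄`-annihilator of
the genuine vectors — i.e. (i) breaks because `algAnn` sees only the `ℚ̄`-STRUCTURE of the table (a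
transcendental coincidence among the `p^±(π)` would shrink it), or the probe types of weight `wt'` prime to
`N` are too few in the tree to run (iii). [cite: LuoRamakrishnan1997, Thm A] [cite: JacquetShalikaAJM1981, Thm 4.8] [cite: HarishChandra1968, Thm 1] -/
theorem stub_annihilatorConverse (hI : EulerIndependence) (m : ℕ) (hm : 1 ≤ m) (N : ℕ) (hN : 1 ≤ N)
    (wt : Fin (m + 1) → ℤ) (wt' : Fin m → ℤ) (hw : AdmissibleWitness m wt wt') (hc : CompactFacts) (s₀ : ℂ)
    (De Do : ProbeType m hc → ℂ) (δ : ProbeType m hc → HeightOneSpectrum (𝓞 ℚ) → Multiset ℂ)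
    (hD : GoodDatum De Do) (htot : TableTotal N wt wt' s₀ De Do δ) (hrat : TableRational N wt wt' s₀ De Do δ) :
    Converse N wt s₀ De Do δ (algAnn N wt wt' s₀ De Do δ) := by
  sorry

/-! ## 3. The stub statements as named propositions (hypotheses of the composition, by name) -/

namespace _Goal

/-- The statement of `stub_genuineValueTable` (literally its type). [folklore] -/
@[folklore] def stub_genuineValueTable : Prop :=
  type_of% @Summit.Langlands.Langlands.Cruxes.AlgebraicRelationsDecide.Birth.stub_genuineValueTable

/-- The statement of `stub_eulerIndependence` (literally its type, i.e. `EulerIndependence`). [folklore] -/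
@[folklore] def stub_eulerIndependence : Prop :=
  type_of% @Summit.Langlands.Langlands.Cruxes.AlgebraicRelationsDecide.Birth.stub_eulerIndependence

/-- The statement of `stub_annihilatorConverse` (literally its type). [folklore] -/
@[folklore] def stub_annihilatorConverse : Prop :=
  type_of% @Summit.Langlands.Langlands.Cruxes.AlgebraicRelationsDecide.Birth.stub_annihilatorConverse

end _Goal

/-! ## 4. Composition (kernel-checked, no `sorry`): STUBS 1–3 ⟹ `AlgebraicRelationsDecide` BY NAME -/

/-- A relation of the algebraic annihilator has algebraic coefficients (definitional). [folklore] -/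
theorem algCoeff_algAnn {m : ℕ} {hc : CompactFacts} (N : ℕ) (wt : Fin (m + 1) → ℤ) (wt' : Fin m → ℤ)
    (s₀ : ℂ) (De Do : ProbeType m hc → ℂ) (δ : ProbeType m hc → HeightOneSpectrum (𝓞 ℚ) → Multiset ℂ) :
    AlgCoeff (algAnn N wt wt' s₀ De Do δ) :=
  fun _ hr => hr.1

/-- NECESSITY for the algebraic annihilator from the EXISTENCE clause alone, with `γ := ∅`: the classically
chosen total value vector of a genuine `(π, απ)` is a genuine vector, so every relation of `algAnn` vanishes
on it, and relations are supported on standard probes where it has the value property. [folklore] -/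
theorem necessity_algAnn {m : ℕ} {hc : CompactFacts} (N : ℕ) (wt : Fin (m + 1) → ℤ) (wt' : Fin m → ℤ)
    (s₀ : ℂ) (De Do : ProbeType m hc → ℂ) (δ : ProbeType m hc → HeightOneSpectrum (𝓞 ℚ) → Multiset ℂ)
    (htot : TableTotal N wt wt' s₀ De Do δ) :
    Necessity N wt s₀ De Do δ (algAnn N wt wt' s₀ De Do δ) := by
  intro π hπ απ hαπ
  refine ⟨noBad, ?_⟩
  -- the total value vector of (π, απ) on the standard probes, 0 elsewhere
  have hex : ∀ p : Probe m hc, StdProbe N wt' p → ∃ zp : ℂ, ProbeValue N s₀ De Do δ απ noBad p zp :=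
    htot π hπ απ hαπ
  let z : Probe m hc → ℂ := fun p => if hp : StdProbe N wt' p then Classical.choose (hex p hp) else 0
  have hz : ∀ p : Probe m hc, StdProbe N wt' p → ProbeValue N s₀ De Do δ απ noBad p (z p) := by
    intro p hp
    have e : z p = Classical.choose (hex p hp) := dif_pos hp
    rw [e]
    exact Classical.choose_spec (hex p hp)
  have hgen : IsGenuineVector N wt wt' s₀ De Do δ z := ⟨π, απ, hπ, hαπ, hz⟩
  intro r hr
  exact ⟨z, fun p hp => hz p (hr.2.1 p hp), hr.2.2 z hgen⟩

/-- **`AlgebraicRelationsDecide` from the three stubs.** Take the datum `(wt', s₀, D_even, D_odd, δ)` of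
STUB 1 and the relation set `R := algAnn` (the algebraic annihilator of the genuine `γ = ∅` value table on
the standard probes of weight `wt'`): its coefficients are algebraic by definition, NECESSITY is
`necessity_algAnn` (the EXISTENCE clause of STUB 1), and CONVERSE is STUB 3 fed STUB 2, the non-vanishing of
`D` and both clauses of STUB 1. [folklore] -/
theorem AlgebraicRelationsDecide_of (h₁ : _Goal.stub_genuineValueTable) (h₂ : _Goal.stub_eulerIndependence)
    (h₃ : _Goal.stub_annihilatorConverse) : AlgebraicRelationsDecide := by
  have H₁ : ∀ (m : ℕ), 1 ≤ m → ∀ (N : ℕ), 1 ≤ N → ∀ (wt : Fin (m + 1) → ℤ),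
      (∃ wt' : Fin m → ℤ, AdmissibleWitness m wt wt') → ∀ (hc : CompactFacts),
      ∃ (wt' : Fin m → ℤ) (s₀ : ℂ) (De Do : ProbeType m hc → ℂ)
        (δ : ProbeType m hc → HeightOneSpectrum (𝓞 ℚ) → Multiset ℂ),
        AdmissibleWitness m wt wt' ∧ GoodDatum De Do ∧
          TableTotal N wt wt' s₀ De Do δ ∧ TableRational N wt wt' s₀ De Do δ := h₁
  have H₂ : EulerIndependence := h₂
  have H₃ : ∀ (_ : EulerIndependence) (m : ℕ), 1 ≤ m → ∀ (N : ℕ), 1 ≤ N → ∀ (wt : Fin (m + 1) → ℤ)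
      (wt' : Fin m → ℤ), AdmissibleWitness m wt wt' → ∀ (hc : CompactFacts) (s₀ : ℂ)
      (De Do : ProbeType m hc → ℂ) (δ : ProbeType m hc → HeightOneSpectrum (𝓞 ℚ) → Multiset ℂ),
      GoodDatum De Do → TableTotal N wt wt' s₀ De Do δ → TableRational N wt wt' s₀ De Do δ →
      Converse N wt s₀ De Do δ (algAnn N wt wt' s₀ De Do δ) := h₃
  rw [algebraicRelationsDecide_iff]
  intro m hm N hN wt hwt hc
  obtain ⟨wt', s₀, De, Do, δ, hw, hD, htot, hrat⟩ := H₁ m hm N hN wt hwt hc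
  exact ⟨s₀, De, Do, δ, algAnn N wt wt' s₀ De Do δ, algCoeff_algAnn N wt wt' s₀ De Do δ,
    necessity_algAnn N wt wt' s₀ De Do δ htot,
    H₃ H₂ m hm N hN wt wt' hw hc s₀ De Do δ hD htot hrat⟩

/-- By-name sanity check (an `example`, not a declaration): the three stubs feed the composition. -/
example : AlgebraicRelationsDecide :=
  AlgebraicRelationsDecide_of stub_genuineValueTable stub_eulerIndependence stub_annihilatorConverse

end Summit.Langlands.Langlands.Cruxes.AlgebraicRelationsDecide.Birth

end
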